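import Literature.AnabelianGeometry.SemiGraphs.SubgraphComponentsDoubleCosetsOfDetected
import Literature.AnabelianGeometry.SemiGraphs.TieLabelsOfDetectedOver
import Literature.AnabelianGeometry.SemiGraphs.SectionFibreSaturationOver
import HarnessLib

/-!
# (D3) `covering_subgraphComponents_doubleCosets` WITHOUT branch alignment from detection OVER `ℍ` ONLY ([SemiAnbd] Cor. 2.7 (i) p. 30)

Mochizuki, *Semi-graphs of anabelioids*, Publ. RIMS **42** (2006), §2, proof of Cor. 2.7 (i) p. 30
("`ℋ′` injects into `𝒢′` as a subgraph": along the finite étale covering `𝒢′ → 𝒢` attached to `A`,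
the preimage components of a connected sub-graph `ℍ` ARE the coverings of `𝒢_ℍ` attached to the
components of `A|_ℍ`) [cite: MochizukiSemiAnbd2006, Cor. 2.7(i) p.30]; Def. 2.2 (i) p. 23, Rem. 2.2.1 p. 24.

PROOF-ONLY (abc-iut cell, layer L3; FACT-LIST row F-1487 `covering_subgraphComponents_doubleCosets`
AS TYPED — local ∧ global ∧ vertex-aligned, NO branch alignment —, CLASS route «regluing invisibility»
of abc-iut-w4-d080, brick R6c «LOCALISED TIE», file E2c; seat abc-iut-f-161 (gen 13), L3-lead ζ3;
SHAPES `HOME/staging/f/f-161/g13/SHAPES-R6c.md`).  abc-iut-f-161 gen 11's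
`SubgraphComponentsDoubleCosetsOfDetected` proves (Surj) and the body of (D3) for every covering all of
whose edge-cells are DETECTED; its chain consumes detection only over the edges of `ℍ` (E2a
`Hom.tie_localLabels_of_sectionE_surjectiveOn`, E2b `Hom.sectionFibres_saturate_over`).  This file
re-runs the two theorems on detection OVER `ℍ` ONLY:

* `Hom.stabilizer_le_range_restrict_of_sectionE_surjectiveOn` — (Surj) `Stab_{Π_ℍ}(x) ≤ ι_ψ(Π_K)` for
  every covering which is local ∧ global (data `(α, e_B)`) ∧ vertex-aligned with every edge-cell of
  `𝔾_A` OVER AN EDGE OF `ℍ` detected w.r.t. `(α, e_B)`;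
* `covering_subgraphComponents_doubleCosets_of_sectionE_surjectiveOn` — the body of (D3) (all four
  conclusions) for every such covering and that `ℍ`.

Since `ℍ` is a GRAPH, its edges are CLOSED in `𝔾`: OPEN edge-cells of `𝔾_A` never have to be detected
(the closers over CLOSED cells follow in `SubgraphComponentsDoubleCosetsOfClosedCells`).  Strict
generalisations (weaker hypotheses, same conclusions) of the two tree theorems, which are not restated.
Consolidation TODO (not tonight, abc-iut-L3-lead ζ11): the tree's global theorems are the
`S = univ` + connected corollaries of the `_over` / `…On` forms and could be re-derived from them.
No definition, no instance, no new named fact; typed ≠ proved for F-1487 AS TYPED (OPEN-AS-TYPED,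
L3-lead δ22); CLASS route ≠ the fact; nothing here takes a side on [IUTchIII] Cor. 3.12.
-/

namespace Literature.AnabelianGeometry.SemiGraphs

namespace SemiGraphOfAnabelioids

open CategoryTheory CategoryTheory.Limits CategoryTheory.Functor CategoryTheory.PreGaloisCategory
open Literature.AnabelianGeometry.Anabelioids
open scoped Pointwise

universe v₁ u₁ u

variable {𝒢 𝒢' : SemiGraphOfAnabelioids.{v₁, u₁, u}}

/-- **(Surj) for coverings whose edge-cells OVER `ℍ` are detected** ([SemiAnbd] p. 30, "`ℋ′` injects into
`𝒢′`"; Def. 2.2 (i) p. 23 WITHOUT branch alignment): for connected `𝒢`, `𝒢′`, `φ : 𝒢′ → 𝒢` locally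
the covering attached to `A`, globally so through `α : B(𝒢)_{/A} ⥲ B(𝒢′)`, `e_B : φ^* ≅ (A × −) ⋙ α`,
vertex-aligned, a connected sub-graph `ℍ` with EVERY edge-cell `(e, Q)` of `𝔾_A` OVER AN EDGE OF `ℍ`
DETECTED (some edge `e′` of `𝒢′` over `e` has
the constituent `g_{e′}` of the tautological section `g = α(η_{𝟙_A}) ≫ e_B⁻¹_A` factoring through
`φ_{e′}^*(Q ↪ A_e)`), a preimage component `K ∋ w″`, basepoints
`(F″, F₂, e₂)` and a point `x` of `F₂(A_u)` fixed by `ι″(Π_{𝒢′})`: `Stab_{Π_ℍ}(x) ≤ ι_ψ(Π_K)` for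
`ψ := φ|_K : 𝒢′|_K → 𝒢|_ℍ` (abc-iut-L3-d3's proof verbatim, run on the LOCALISED TIE
`tie_localLabels_of_sectionE_surjectiveOn` at `S := ℍ.edges` and the localised sheet walk
`sectionFibres_saturate_over`).
[cite: MochizukiSemiAnbd2006, Cor. 2.7(i) p.30] -/
theorem Hom.stabilizer_le_range_restrict_of_sectionE_surjectiveOn (φ : Hom 𝒢' 𝒢) (A : 𝒢.BObj)
    [HasBinaryProducts 𝒢.BObj] (α : Over A ⥤ 𝒢'.BObj) [α.IsEquivalence]
    (eB : φ.pullbackFunctor ≅ Over.star A ⋙ α)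
    (h𝒢 : 𝒢.IsConnected) (h𝒢' : 𝒢'.IsConnected) (hloc : φ.IsFiniteEtaleCoveringOf A)
    (hva : φ.IsVertexAligned)
    (H : 𝒢.graph.Subgraph) (hH : H.toSemiGraph.IsConnected) (hHg : H.toSemiGraph.IsGraph)
    (hdet : ∀ e ∈ H.edges, ∀ (Q : π₀Obj (A.T e)),
      ∃ (e' : 𝒢'.graph.Edge) (Q' : π₀Obj (A.T (φ.base.edgeMap e'))),
        (⟨φ.base.edgeMap e', Q'⟩ : Σ e, π₀Obj (A.T e)) = ⟨e, Q⟩ ∧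
        ∃ k : (α.obj (Over.mk (𝟙 A))).T e' ⟶
            (φ.φE e' (φ.base.edgeMap e') rfl).pullback.obj (Q'.1 : 𝒢.E (φ.base.edgeMap e')),
          k ≫ (φ.φE e' (φ.base.edgeMap e') rfl).pullback.map Q'.1.arrow =
            (α.map ((Over.forgetAdjStar A).unit.app (Over.mk (𝟙 A))) ≫ eB.inv.app A).fT e')
    (K : {K : 𝒢'.graph.Subgraph // φ.IsPreimageComponent H K})
    (w'' : K.1.toSemiGraph.Vertex) (F'' : 𝒢'.V w''.1 ⥤ FintypeCat.{v₁}) [FiberFunctor F'']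
    (F₂ : 𝒢.V (φ.base.vertexMap w''.1) ⥤ FintypeCat.{v₁}) [FiberFunctor F₂]
    (e₂ : (φ.φV w''.1).pullback ⋙ F'' ≅ F₂)
    (x : (𝒢.ρ (φ.base.vertexMap w''.1) ⋙ F₂).obj A)
    (hx : ((Aut.autMulEquivOfIso (isoWhiskerLeft (𝒢.ρ (φ.base.vertexMap w''.1)) e₂)
          ).toMonoidHom.comp (pi1Map φ.pullbackFunctor (𝒢'.ρ w''.1 ⋙ F''))).range ≤
        MulAction.stabilizer (𝒢.Pi (φ.base.vertexMap w''.1) F₂) x) :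
    MulAction.stabilizer (𝒢.PiH H ⟨φ.base.vertexMap w''.1, K.2.2.2.2.1 w''.2⟩ F₂)
        (show ((𝒢.restrict H).ρ ⟨φ.base.vertexMap w''.1, K.2.2.2.2.1 w''.2⟩ ⋙ F₂).obj
          ((𝒢.restrictFunctor H).obj A) from x) ≤
      ((Aut.autMulEquivOfIso
            (isoWhiskerLeft ((𝒢.restrict H).ρ ⟨φ.base.vertexMap w''.1, K.2.2.2.2.1 w''.2⟩)
              e₂)).toMonoidHom.comp
          (pi1Map (φ.restrict K.1 H K.2.2.2.2.1 K.2.2.2.2.2.1).pullbackFunctor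
            ((𝒢'.restrict K.1).ρ w'' ⋙ F''))).range := by
  have hKV : K.1.verts ⊆ φ.base.vertexMap ⁻¹' H.verts := K.2.2.2.2.1
  have hKE : K.1.edges ⊆ φ.base.edgeMap ⁻¹' H.edges := K.2.2.2.2.2.1
  have hBc : φ.IsGlobalCoveringOf A := ⟨‹_›, α, ‹_›, ⟨eB⟩⟩
  -- the global terminal object and the tautological section
  let T : 𝒢'.BObj := α.obj (Over.mk (𝟙 A))
  have hT : IsTerminal T := Over.mkIdTerminal.isTerminalObj α _
  have hTV : ∀ v', IsTerminal (T.S v') := fun v' => by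
    haveI := preservesTerminal_ρ 𝒢' v'
    exact hT.isTerminalObj (𝒢'.ρ v') _
  have hTE : ∀ e', IsTerminal (T.T e') := fun e' => by
    haveI := (𝒢'.hasLimitsOfShape_bObj (J := Discrete PEmpty.{1})).2.2 e'
    exact hT.isTerminalObj (𝒢'.ρE e') _
  let s : T ⟶ φ.pullbackFunctor.obj A :=
    α.map ((Over.forgetAdjStar A).unit.app (Over.mk (𝟙 A))) ≫ eB.inv.app A
  -- the TIE labels from detection (abc-iut-L3-d2, over abc-iut-f-161's labelled lift)
  obtain ⟨O, OE, hOinj, -, hOEsurj, hOiff, hOEiff, hbr⟩ :=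
    φ.tie_localLabels_of_sectionE_surjectiveOn A α eB hloc hva H.edges hdet
  have hsV : ∀ v', ∃ k : T.S v' ⟶ (φ.φV v').pullback.obj (O v').1,
      k ≫ (φ.φV v').pullback.map (O v').1.arrow = s.fS v' := fun v' => (hOiff v' (O v')).mp rfl
  have hsE : ∀ e', ∃ k : T.T e' ⟶ (φ.φE e' (φ.base.edgeMap e') rfl).pullback.obj (OE e').1,
      k ≫ (φ.φE e' (φ.base.edgeMap e') rfl).pullback.map (OE e').1.arrow = s.fT e' :=
    fun e' => (hOEiff e' (OE e')).mp rfl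
  -- vertex alignment at the section points
  obtain ⟨hprop, cV, cE, -, -, hlocV, -, -⟩ := hloc
  have hVAK : ∀ (w : 𝒢'.graph.Vertex) (_ : w ∈ K.1.verts) (F' : 𝒢'.V w ⥤ FintypeCat.{v₁})
      [FiberFunctor F'] (F : 𝒢.V (φ.base.vertexMap w) ⥤ FintypeCat.{v₁}) [FiberFunctor F]
      (e : (φ.φV w).pullback ⋙ F' ≅ F) (t : F'.obj (T.S w)),
      MulAction.stabilizer (Aut F) (e.hom.app (A.S (φ.base.vertexMap w)) (F'.map (s.fS w) t)) ≤
        ((Aut.autMulEquivOfIso e).toMonoidHom.comp (pi1Map (φ.φV w).pullback F')).range := by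
    intro w _ F' _ F _ e t
    -- the global base point: `range ι = Stab_{Π_𝒢}(a₀)`
    haveI : PreservesLimitsOfShape WalkingCospan (𝒢'.ρ w) := preservesPullbacks_ρ 𝒢' w
    haveI : PreservesLimitsOfShape (Discrete PEmpty.{1}) (𝒢'.ρ w) := preservesTerminal_ρ 𝒢' w
    haveI : PreservesLimitsOfShape WalkingCospan (𝒢'.ρ w ⋙ F') := inferInstance
    haveI : (𝒢'.ρ w ⋙ F').PreservesMonomorphisms := inferInstance
    haveI : Subsingleton ((𝒢'.ρ w ⋙ F').obj (α.obj (Over.mk (𝟙 A)))) :=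
      subsingleton_fiber_of_isTerminal F' (hTV w)
    have ha := range_pi1Map_eq_stabilizer' α eB (𝒢'.ρ w ⋙ F')
      (isoWhiskerLeft (𝒢.ρ (φ.base.vertexMap w)) e) t
    -- the local base point: `range ι_w = Stab_{Π_u}(p₀)`
    obtain ⟨αw, hαw, ⟨eloc⟩⟩ := hlocV w
    haveI := hαw
    haveI : PreservesFiniteLimits (φ.φV w).pullback := (φ.φV w).property.1
    have hTloc : IsTerminal (αw.obj (Over.mk (𝟙 (Subobject.underlying.obj (cV w).1)))) :=
      Over.mkIdTerminal.isTerminalObj αw _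
    haveI : Subsingleton (F'.obj (αw.obj (Over.mk (𝟙 (Subobject.underlying.obj (cV w).1))))) :=
      subsingleton_fiber_of_isTerminal F' hTloc
    obtain ⟨t'⟩ := nonempty_fiber_of_isTerminal F' hTloc
    have hp := range_pi1Map_eq_stabilizer' αw eloc F' e t'
    have heq := hva.stabilizer_eq_of_ranges w F' F e _ ha (cV w).1.arrow _ hp
    exact (heq.trans hp.symm).le
  -- Galois structures on `B(𝒢_ℍ)` and `B(𝒢′_K)`
  have hKc : (𝒢'.restrict K.1).IsConnected := ⟨K.2.1⟩
  letI := (𝒢.restrict H).galoisCategory_bObj ⟨hH⟩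
  letI := (𝒢'.restrict K.1).galoisCategory_bObj hKc
  let uH : H.toSemiGraph.Vertex := ⟨φ.base.vertexMap w''.1, hKV w''.2⟩
  haveI : @FiberFunctor ((𝒢.restrict H).V uH) ((𝒢.restrict H).catV uH)
      ((𝒢.restrict H).galV uH).toPreGaloisCategory F₂ := ‹FiberFunctor F₂›
  haveI : @FiberFunctor ((𝒢'.restrict K.1).V w'') ((𝒢'.restrict K.1).catV w'')
      ((𝒢'.restrict K.1).galV w'').toPreGaloisCategory F'' := ‹FiberFunctor F''›
  let FC : (𝒢.restrict H).BObj ⥤ FintypeCat.{v₁} := (𝒢.restrict H).ρ uH ⋙ F₂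
  haveI : FiberFunctor FC := (𝒢.restrict H).fiberFunctor_ρ ⟨hH⟩ uH F₂
  let ψ := φ.restrict K.1 H hKV hKE
  let FD : (𝒢'.restrict K.1).BObj ⥤ FintypeCat.{v₁} := (𝒢'.restrict K.1).ρ w'' ⋙ F''
  haveI : FiberFunctor FD := (𝒢'.restrict K.1).fiberFunctor_ρ hKc w'' F''
  let eD : ψ.pullbackFunctor ⋙ FD ≅ FC := isoWhiskerLeft ((𝒢.restrict H).ρ uH) e₂
  let Φ'' : 𝒢.V (φ.base.vertexMap w''.1) ⥤ 𝒢'.V w''.1 := (φ.φV w''.1).pullback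
  -- the section point at `w″`
  haveI : Subsingleton (F''.obj (T.S w''.1)) := subsingleton_fiber_of_isTerminal F'' (hTV _)
  obtain ⟨t₀⟩ := nonempty_fiber_of_isTerminal F'' (hTV w''.1)
  let x₀ : F₂.obj (A.S (φ.base.vertexMap w''.1)) :=
    e₂.hom.app (A.S (φ.base.vertexMap w''.1)) (F''.map (s.fS w''.1) t₀)
  have key : MulAction.stabilizer (Aut FC) (show FC.obj ((𝒢.restrictFunctor H).obj A) from x₀) ≤
      ((Aut.autMulEquivOfIso eD).toMonoidHom.comp (pi1Map ψ.pullbackFunctor FD)).range := by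
    refine stabilizer_le_range_of_forall_connected ψ.pullbackFunctor FD FC eD _ ?_
    intro Y hY g y y' hy hy'
    -- the section condition for a point over `x₀`, read on `F″`
    have hsec : ∀ z : F₂.obj (Y.S uH), F₂.map (g.fS uH) z = x₀ →
        F''.map (Φ''.map (g.fS uH)) (e₂.inv.app (Y.S uH) z) = F''.map (s.fS w''.1) t₀ := by
      intro z hz
      have hnat := FunctorToFintypeCat.naturality F₂ (Φ'' ⋙ F'') e₂.inv (g.fS uH) z
      change (Φ'' ⋙ F'').map (g.fS uH) (e₂.inv.app (Y.S uH) z) = _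
      rw [← hnat, hz]
      exact FintypeCat.hom_inv_id_apply (e₂.app (A.S (φ.base.vertexMap w''.1))) _
    let yt : FD.obj (ψ.pullbackFunctor.obj Y) := e₂.inv.app (Y.S uH) y
    let yt' : FD.obj (ψ.pullbackFunctor.obj Y) := e₂.inv.app (Y.S uH) y'
    obtain ⟨Wc, ω₀, hω₀⟩ := exists_component_mem_range FD yt
    have hω₀' : F''.map (Φ''.map (g.fS uH)) (F''.map ((Wc.1.arrow).fS ⟨w''.1, w''.2⟩) ω₀) =
        F''.map (s.fS w''.1) t₀ := by
      have h1 : F''.map ((Wc.1.arrow).fS ⟨w''.1, w''.2⟩) ω₀ = yt := hω₀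
      rw [h1]
      exact hsec y hy
    have sat := φ.sectionFibres_saturate_over A H K.1 hKV hKE K.2 hprop hHg hH T hTV hTE s O OE hOinj
      hOEsurj hbr hsV hsE hVAK Y hY g Wc.1.arrow w''.1 w''.2 F'' t₀ ω₀ hω₀' w''.1 w''.2 F'' t₀ yt' (hsec y' hy')
    -- both points lie in the connected component `Wc` of `ψ^* Y`: one orbit
    have horb : Set.range (FD.map Wc.1.arrow) = MulAction.orbit (Aut FD) yt :=
      range_map_arrow_eq_orbit FD Wc ⟨ω₀, hω₀⟩
    have hyt' : yt' ∈ MulAction.orbit (Aut FD) yt := by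
      rw [← horb]
      exact sat
    obtain ⟨γ, hγ⟩ := MulAction.mem_orbit_iff.mp hyt'
    refine ⟨γ, ?_⟩
    have h1 := autMulEquivOfIso_smul_hom_app eD Y (pi1Map ψ.pullbackFunctor FD γ)
      (show (ψ.pullbackFunctor ⋙ FD).obj Y from yt)
    have h2 : eD.hom.app Y yt = y := FintypeCat.inv_hom_id_apply (e₂.app (Y.S uH)) y
    have h3 : eD.hom.app Y yt' = y' := FintypeCat.inv_hom_id_apply (e₂.app (Y.S uH)) y'
    have h4 : (pi1Map ψ.pullbackFunctor FD γ) • (show (ψ.pullbackFunctor ⋙ FD).obj Y from yt) = yt' :=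
      hγ
    rw [h2, h4, h3] at h1
    exact h1
  -- transfer from the section point `x₀` to `x` (same `Π_𝒢`-stabiliser: `A` is connected)
  haveI : PreservesLimitsOfShape WalkingCospan (𝒢'.ρ w''.1) := preservesPullbacks_ρ 𝒢' w''.1
  haveI : PreservesLimitsOfShape (Discrete PEmpty.{1}) (𝒢'.ρ w''.1) := preservesTerminal_ρ 𝒢' w''.1
  haveI : PreservesLimitsOfShape WalkingCospan (𝒢'.ρ w''.1 ⋙ F'') := inferInstance
  haveI : (𝒢'.ρ w''.1 ⋙ F'').PreservesMonomorphisms := inferInstance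
  haveI : Subsingleton ((𝒢'.ρ w''.1 ⋙ F'').obj (α.obj (Over.mk (𝟙 A)))) :=
    subsingleton_fiber_of_isTerminal F'' (hTV w''.1)
  have ha'' := range_pi1Map_eq_stabilizer' α eB (𝒢'.ρ w''.1 ⋙ F'')
    (isoWhiskerLeft (𝒢.ρ (φ.base.vertexMap w''.1)) e₂) t₀
  letI := 𝒢.galoisCategory_bObj h𝒢
  let FG : 𝒢.BObj ⥤ FintypeCat.{v₁} := 𝒢.ρ (φ.base.vertexMap w''.1) ⋙ F₂
  haveI : FiberFunctor FG := 𝒢.fiberFunctor_ρ h𝒢 _ F₂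
  haveI : PreGaloisCategory.IsConnected A := isConnected_of_isGlobalCovering h𝒢' φ A hBc
  have hle : MulAction.stabilizer (Aut FG) (show FG.obj A from x₀) ≤ MulAction.stabilizer (Aut FG) x :=
    ha''.symm.le.trans hx
  have hne : (MulAction.stabilizer (Aut FG) x).index ≠ 0 := by
    rw [MulAction.index_stabilizer_of_transitive]
    exact Nat.card_ne_zero.mpr ⟨⟨x⟩, inferInstance⟩
  have hidx : (MulAction.stabilizer (Aut FG) (show FG.obj A from x₀)).index =
      (MulAction.stabilizer (Aut FG) x).index := by
    rw [MulAction.index_stabilizer_of_transitive, MulAction.index_stabilizer_of_transitive]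
  have hge : MulAction.stabilizer (Aut FG) x ≤ MulAction.stabilizer (Aut FG) (show FG.obj A from x₀) := by
    have h := Subgroup.relIndex_mul_index hle
    rw [hidx] at h
    exact Subgroup.relIndex_eq_one.mp ((mul_eq_right₀ hne).mp h)
  -- `Π_ℍ` acts on the fibre of `A|_ℍ` through `Π_ℍ → Π_𝒢` (definitionally)
  intro σ hσ
  have hσ' : 𝒢.piHToPi H uH F₂ σ ∈ MulAction.stabilizer (Aut FG) x := hσ
  have hσ₀ : 𝒢.piHToPi H uH F₂ σ ∈ MulAction.stabilizer (Aut FG) (show FG.obj A from x₀) := hge hσ'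
  exact key hσ₀

/-- **(D3) for coverings whose edge-cells OVER `ℍ` are detected — [SemiAnbd] Cor. 2.7 (i) p. 30, "`ℋ′`
injects into `𝒢′` as a subgraph", WITHOUT the branch-alignment clause of Def. 2.2 (i).**  For
connected `𝒢`, `𝒢′` and `φ : 𝒢′ → 𝒢` local ∧ global (data `(α, e_B)`) ∧ vertex-aligned with every
edge-cell of `𝔾_A` OVER AN EDGE OF `ℍ` DETECTED w.r.t. `(α, e_B)`: with `Π′ := ι(Π_{𝒢′}) = Stab(x₀)` and `Π_ℍ ≤ Π_𝒢` the
decomposition group of a connected sub-graph `ℍ`, (P1) the preimage components of `ℍ` correspond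
bijectively to `Π_ℍ \ Π_𝒢 / Π′` via `K ↦ Π_ℍ d(K) Π′`, (P2) the component through `v′` exists, (P3) it
goes to the class of `Π′` with `ι(Π_{K₀}) = Π′ ∩ Π_ℍ`, (P4) `ι(Π_K) = Π′ ∩ g⁻¹ Π_ℍ g` at every vertex of
every component ((ST) from `Hom.stabilizer_le_range_restrict_of_sectionE_surjectiveOn` +
`Hom.range_restrict_le_stabilizer_of_range_le`, then `…_body_of_stabilizers`).
[cite: MochizukiSemiAnbd2006, Cor. 2.7(i) p.30] -/
theorem covering_subgraphComponents_doubleCosets_of_sectionE_surjectiveOn (φ : Hom 𝒢' 𝒢) (A : 𝒢.BObj)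
    [HasBinaryProducts 𝒢.BObj] (α : Over A ⥤ 𝒢'.BObj) [α.IsEquivalence]
    (eB : φ.pullbackFunctor ≅ Over.star A ⋙ α)
    (h𝒢 : 𝒢.IsConnected) (h𝒢' : 𝒢'.IsConnected) (hloc : φ.IsFiniteEtaleCoveringOf A)
    (hva : φ.IsVertexAligned)
    (v' : 𝒢'.graph.Vertex) (F' : 𝒢'.V v' ⥤ FintypeCat.{v₁}) [FiberFunctor F']
    (F : 𝒢.V (φ.base.vertexMap v') ⥤ FintypeCat.{v₁}) [FiberFunctor F]
    (e : (φ.φV v').pullback ⋙ F' ≅ F)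
    (H : 𝒢.graph.Subgraph) (hH : H.toSemiGraph.IsConnected) (hHg : H.toSemiGraph.IsGraph)
    (hv : φ.base.vertexMap v' ∈ H.verts)
    (hdet : ∀ e ∈ H.edges, ∀ (Q : π₀Obj (A.T e)),
      ∃ (e' : 𝒢'.graph.Edge) (Q' : π₀Obj (A.T (φ.base.edgeMap e'))),
        (⟨φ.base.edgeMap e', Q'⟩ : Σ e, π₀Obj (A.T e)) = ⟨e, Q⟩ ∧
        ∃ k : (α.obj (Over.mk (𝟙 A))).T e' ⟶
            (φ.φE e' (φ.base.edgeMap e') rfl).pullback.obj (Q'.1 : 𝒢.E (φ.base.edgeMap e')),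
          k ≫ (φ.φE e' (φ.base.edgeMap e') rfl).pullback.map Q'.1.arrow =
            (α.map ((Over.forgetAdjStar A).unit.app (Over.mk (𝟙 A))) ≫ eB.inv.app A).fT e')
    (x₀ : (𝒢.ρ (φ.base.vertexMap v') ⋙ F).obj A)
    (hx₀ : ((Aut.autMulEquivOfIso (isoWhiskerLeft (𝒢.ρ (φ.base.vertexMap v')) e)
        ).toMonoidHom.comp (pi1Map φ.pullbackFunctor (𝒢'.ρ v' ⋙ F'))).range =
      MulAction.stabilizer (𝒢.Pi (φ.base.vertexMap v') F) x₀) :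
    ∃ d : {K : 𝒢'.graph.Subgraph // φ.IsPreimageComponent H K} → 𝒢.Pi (φ.base.vertexMap v') F,
      Function.Bijective (fun K => DoubleCoset.mk (𝒢.piHToPi H ⟨φ.base.vertexMap v', hv⟩ F).range
        ((Aut.autMulEquivOfIso (isoWhiskerLeft (𝒢.ρ (φ.base.vertexMap v')) e)
          ).toMonoidHom.comp (pi1Map φ.pullbackFunctor (𝒢'.ρ v' ⋙ F'))).range (d K)) ∧
      (∃ K₀ : {K : 𝒢'.graph.Subgraph // φ.IsPreimageComponent H K}, v' ∈ K₀.1.verts) ∧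
      (∀ (K : {K : 𝒢'.graph.Subgraph // φ.IsPreimageComponent H K}) (hK : v' ∈ K.1.verts),
        d K ∈ ((Aut.autMulEquivOfIso (isoWhiskerLeft (𝒢.ρ (φ.base.vertexMap v')) e)
            ).toMonoidHom.comp (pi1Map φ.pullbackFunctor (𝒢'.ρ v' ⋙ F'))).range ∧
          (((Aut.autMulEquivOfIso (isoWhiskerLeft (𝒢.ρ (φ.base.vertexMap v')) e)
              ).toMonoidHom.comp (pi1Map φ.pullbackFunctor (𝒢'.ρ v' ⋙ F'))).comp
              (𝒢'.piHToPi K.1 ⟨v', hK⟩ F')).range =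
            ((Aut.autMulEquivOfIso (isoWhiskerLeft (𝒢.ρ (φ.base.vertexMap v')) e)
                ).toMonoidHom.comp (pi1Map φ.pullbackFunctor (𝒢'.ρ v' ⋙ F'))).range ⊓
              (𝒢.piHToPi H ⟨φ.base.vertexMap v', hv⟩ F).range) ∧
      ∀ (K : {K : 𝒢'.graph.Subgraph // φ.IsPreimageComponent H K})
        (w'' : K.1.toSemiGraph.Vertex) (F'' : 𝒢'.V w''.1 ⥤ FintypeCat.{v₁}) [FiberFunctor F'']
        (β : 𝒢'.ρ w''.1 ⋙ F'' ≅ 𝒢'.ρ v' ⋙ F'),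
        ∃ g : 𝒢.Pi (φ.base.vertexMap v') F,
          (((Aut.autMulEquivOfIso (isoWhiskerLeft (𝒢.ρ (φ.base.vertexMap v')) e)
              ).toMonoidHom.comp (pi1Map φ.pullbackFunctor (𝒢'.ρ v' ⋙ F'))).comp
              ((Aut.autMulEquivOfIso β).toMonoidHom.comp (𝒢'.piHToPi K.1 w'' F''))).range =
            ((Aut.autMulEquivOfIso (isoWhiskerLeft (𝒢.ρ (φ.base.vertexMap v')) e)
                ).toMonoidHom.comp (pi1Map φ.pullbackFunctor (𝒢'.ρ v' ⋙ F'))).range ⊓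
              ConjAct.toConjAct g⁻¹ • (𝒢.piHToPi H ⟨φ.base.vertexMap v', hv⟩ F).range := by
  have hB : φ.IsGlobalCoveringOf A := ⟨‹_›, α, ‹_›, ⟨eB⟩⟩
  refine covering_subgraphComponents_doubleCosets_body_of_stabilizers h𝒢 h𝒢' φ A hloc hB v' F' F e
    H hH hHg hv ?_ x₀ hx₀
  intro K w'' F'' _ F₂ _ e₂
  -- the section point of the global clause: `ι″(Π_{𝒢′}) = Stab(a)`
  obtain ⟨a, -, ha⟩ := covering_decompositionGroup_of_isGlobalCoveringOf φ A hB w''.1 F'' F₂ e₂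
  refine ⟨a, le_antisymm ?_ ?_, ha⟩
  · exact φ.range_restrict_le_stabilizer_of_range_le K.1 H K.2.2.2.2.1 K.2.2.2.2.2.1 w'' F'' F₂ e₂ A
      a ha.le
  · exact φ.stabilizer_le_range_restrict_of_sectionE_surjectiveOn A α eB h𝒢 h𝒢' hloc hva H hH hHg
      hdet K w'' F'' F₂ e₂ a ha.le

end SemiGraphOfAnabelioids

end Literature.AnabelianGeometry.SemiGraphs
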